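import Literature.Analysis.FluidPDE.Wei2016SliceODE
import Literature.Analysis.FluidPDE.Wei2016EnergyBalanceA
import Literature.Analysis.FluidPDE.LimitLerayHopf
import Literature.Analysis.FluidPDE.SerrinEnstrophyGronwall
import HarnessLib

/-!
# Wei 2016, proof of Thm. 1.1: `d/dt F(A) ≥ −C M₂ ‖∇u‖²`, integrated along a Tao-class solution

Analysis/FluidPDE proof file (theorems only; no definitions, no named facts) on the way to
`Literature.Analysis.FluidPDE.Wei2016_logModulus_regularity`
(`LeiZhang2017AxisymmetricCriteria.lean`), after D. Wei, J. Math. Anal. Appl. 435 (2016) =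
arXiv:1508.03318, proof of Thm. 1.1: "`d/dt A(t) ≤ CM₂‖∇u(t)‖² max{A^{4/3}/(εK)^{8/3}, r₀⁻⁴}`.
Set `F(y) = ∫_y^{+∞} (max{y'^{4/3}/(εK)^{8/3}, r₀⁻⁴})⁻¹ dy'`, then `d/dt F(A(t)) ≥ −CM₂‖∇u(t)‖²`
and `F(A(t)) ≥ F(A(0)) − CM₂‖u₀‖²₂/2`."

`IsTaoSolutionOn.F_energyA_le` proves this for a Tao-class solution `v` of the unforced system
(`ν = 1`) on `[0, T]` with axisymmetric slices, under the hypotheses of Lemma 2.3 uniformly in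
time (`|Γ(t,x)| ≤ ε` for `0 < r ≤ r₀`, `|Γ| ≤ Γ_b`, `t ∈ [0, T]`) and the parameter relations of
`Wei2016.slice_ode_bound` (`0 < ε ≤ 1`, `p³ = ε`, `0 ≤ θ ≤ 1`, `K ≥ 1`,
`ε(1 + ln K + ½ln²K) = θ/p`):
`F(A(0)) − C_g M₂ E(u₀) ≤ F(A(t))` for `t ∈ [0, T]`, where `A(t) = ∫J(t)² + ½p²∫Ω(t)²`,
`E(u₀) = ½∫|u₀|²` (`VectorCalculus.kineticEnergy`), `F = Wei2016.F ((εK)^{8/3}) (r₀⁴)⁻¹`,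
`M₂ = θ + pΓ_b + Γ_b²/p²` and `C_g` the constant of `slice_ode_bound`. Ingredients:
`IsTaoSolutionOn.energyA_balance` (`A(t) − A(s) = ∫ₛᵗ φ`, `φ` integrable, `A` continuous),
`Wei2016.slice_ode_bound` (`φ ≤ C_g M₂ ‖Dv‖₂² max{…}` at each time, the dissipation being
nonnegative), `‖Dv‖² ≤ |Dv|²_F` and the energy identity of the Tao class
(`energyEq_of_hasBoundedSobolevNormsOn`: `∫₀ᵗ∫|Dv|²_F ≤ E(u₀)`), the continuity of the enstrophy
(`IsSmoothSpaceTimeOn.enstrophy_balance`), and the comparison `Wei2016.F_sub_le_F_of_integral_le`.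

## References

* D. Wei, arXiv:1508.03318, proof of Thm. 1.1 (the `F`-comparison). [Wei2016]
-/

noncomputable section

open MeasureTheory Set Function Filter Topology InnerProductSpace intervalIntegral
open scoped RealInnerProductSpace ContDiff ENNReal NNReal Topology

namespace Literature.Analysis.FluidPDE

section Apriori

variable {T : ℝ} {u₀ : EuclideanSpace ℝ (Fin 3) → EuclideanSpace ℝ (Fin 3)}
  {v : ℝ → EuclideanSpace ℝ (Fin 3) → EuclideanSpace ℝ (Fin 3)} {q : ℝ → EuclideanSpace ℝ (Fin 3) → ℝ}

/-- `∫₀ᵗ ∫ |Dv|²_F ≤ E(u₀)` along a Tao-class solution of the unforced system with `ν = 1`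
(the energy identity `E(v(t)) + ∫₀ᵗ∫|Dv|²_F = E(u₀)`, `energyEq_of_hasBoundedSobolevNormsOn`,
with the dissipation rewritten as a Bochner integral of the continuous enstrophy
`t ↦ ∫ |Dv(t)|²_F`). [cite: Wei2016, proof of Thm. 1.1 ("`F(A(t)) ≥ F(A(0)) − CM₂‖u₀‖²/2`")] -/
theorem IsTaoSolutionOn.intervalIntegral_enstrophy_le (h : IsTaoSolutionOn T 1 u₀ v q) (hT : 0 < T)
    {t : ℝ} (ht : t ∈ Icc 0 T) :
    ∫ τ in (0 : ℝ)..t, ∫ x, frobeniusNormSq (fderiv ℝ (v τ) x) ≤ VectorCalculus.kineticEnergy u₀ := by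
  have hsm : IsSmoothSpaceTimeOn (Icc 0 T) v := h.classical.smooth_velocity
  have hvs : ∀ s ∈ Icc 0 T, ContDiff ℝ ∞ (v s) := fun s hs => h.classical.contDiff_velocity hs
  -- the energy identity
  have hE := energyEq_of_hasBoundedSobolevNormsOn hT h.classical h.sobolev h.sobolev_p h.continuousL2
    (s := 0) (t := t) le_rfl ht.1 ht.2
  rw [h.initial, one_mul] at hE
  have hKt : 0 ≤ VectorCalculus.kineticEnergy (v t) := kineticEnergy_nonneg _
  have hD : (∫⁻ τ in Ioo 0 t, ∫⁻ x, ENNReal.ofReal (frobeniusNormSq (fderiv ℝ (v τ) x))).toReal ≤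
      VectorCalculus.kineticEnergy u₀ := by linarith
  -- continuity of the enstrophy, integrability of the slices
  obtain ⟨C₁, hC₁⟩ := h.sobolev 1
  obtain ⟨C₂, hC₂⟩ := h.sobolev_dt 1
  obtain ⟨-, hcont, -⟩ := hsm.enstrophy_balance hT hC₁ hC₂
  have hslice : ∀ τ ∈ Icc 0 T, Integrable (fun x => frobeniusNormSq (fderiv ℝ (v τ) x)) volume := by
    intro τ hτ
    have h1 : ContDiff ℝ 1 (v τ) := (hvs τ hτ).of_le (by norm_cast)
    have hc : Continuous fun x => frobeniusNormSq (fderiv ℝ (v τ) x) :=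
      continuous_frobeniusNormSq_fderiv h1 one_ne_zero
    refine ⟨hc.aestronglyMeasurable, ?_⟩
    rw [HasFiniteIntegral]
    calc ∫⁻ x, ‖frobeniusNormSq (fderiv ℝ (v τ) x)‖ₑ
        = ∫⁻ x, ENNReal.ofReal (frobeniusNormSq (fderiv ℝ (v τ) x)) :=
          lintegral_congr fun x => by rw [Real.enorm_eq_ofReal (frobeniusNormSq_nonneg _)]
      _ ≤ ∫⁻ x, 3 * ‖iteratedFDeriv ℝ 1 (v τ) x‖ₑ ^ 2 := lintegral_mono fun x => by
          rw [← ofReal_norm, norm_iteratedFDeriv_one, ofReal_norm]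
          exact ofReal_frobeniusNormSq_le_three_mul_enorm_sq _
      _ = 3 * ∫⁻ x, ‖iteratedFDeriv ℝ 1 (v τ) x‖ₑ ^ 2 := lintegral_const_mul' _ _ (by simp)
      _ < ⊤ := ENNReal.mul_lt_top (by simp) ((hC₁ τ hτ).trans_lt ENNReal.coe_lt_top)
  -- identification of the dissipation with the Bochner integral
  have hinner : ∀ τ ∈ Icc 0 T, ∫⁻ x, ENNReal.ofReal (frobeniusNormSq (fderiv ℝ (v τ) x)) =
      ENNReal.ofReal (∫ x, frobeniusNormSq (fderiv ℝ (v τ) x)) := fun τ hτ =>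
    (ofReal_integral_eq_lintegral_ofReal (hslice τ hτ)
      (Eventually.of_forall fun x => frobeniusNormSq_nonneg _)).symm
  set G : ℝ → ℝ := fun τ => ∫ x, frobeniusNormSq (fderiv ℝ (v τ) x) with hG
  have hG0 : ∀ τ, 0 ≤ G τ := fun τ => integral_nonneg fun x => frobeniusNormSq_nonneg _
  have hGi : IntegrableOn G (Ioo 0 t) volume :=
    (hcont.mono (Icc_subset_Icc_right ht.2)).integrableOn_Icc.mono_set Ioo_subset_Icc_self
  have hrw : (∫⁻ τ in Ioo 0 t, ∫⁻ x, ENNReal.ofReal (frobeniusNormSq (fderiv ℝ (v τ) x))) =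
      ENNReal.ofReal (∫ τ in Ioo 0 t, G τ) := by
    rw [ofReal_integral_eq_lintegral_ofReal hGi (Eventually.of_forall fun τ => hG0 τ)]
    refine setLIntegral_congr_fun measurableSet_Ioo fun τ hτ => ?_
    exact hinner τ ⟨hτ.1.le, hτ.2.le.trans ht.2⟩
  rw [hrw, ENNReal.toReal_ofReal (setIntegral_nonneg measurableSet_Ioo fun τ _ => hG0 τ)] at hD
  rw [intervalIntegral.integral_of_le ht.1, integral_Ioc_eq_integral_Ioo]
  exact hD

set_option maxHeartbeats 800000 in
/-- **Wei 2016, proof of Thm. 1.1: `F(A(0)) − C M₂ E(u₀) ≤ F(A(t))` along a Tao-class solution.**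
Let `v` be a Tao-class solution of the unforced Navier–Stokes system (`ν = 1`) on `[0, T]` with
axisymmetric slices; let `0 < ε ≤ 1`, `p³ = ε`, `0 ≤ θ ≤ 1`, `K ≥ 1`, `r₀ > 0`, `Γ_b ≥ 0`,
`ε(1 + ln K + ½ln²K) = θ/p`, and assume `|Γ(t, x)| ≤ ε` for `0 < r ≤ r₀` and `|Γ(t, x)| ≤ Γ_b`
for all `t ∈ [0, T]`. Then with `A(t) = ∫J(t)² + ½p²∫Ω(t)²`, `κ = (εK)^{8/3}`, `ρ = r₀⁻⁴` and
the constants `C_g`, `M₂ = θ + pΓ_b + Γ_b²/p²` of `Wei2016.slice_ode_bound`: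
`F κ ρ (A 0) − C_g M₂ E(u₀) ≤ F κ ρ (A t)` for every `t ∈ [0, T]`.
[cite: Wei2016, proof of Thm. 1.1] -/
theorem IsTaoSolutionOn.F_energyA_le (h : IsTaoSolutionOn T 1 u₀ v q) (hT : 0 < T)
    (hax : ∀ t ∈ Icc 0 T, IsAxisymmetric (v t))
    {ε p θ K r₀ Γb : ℝ} (hε : 0 < ε) (hε1 : ε ≤ 1) (hp : 0 < p) (hp3 : p ^ 3 = ε) (hθ0 : 0 ≤ θ)
    (hθ1 : θ ≤ 1) (hK : 1 ≤ K) (hr₀ : 0 < r₀) (hΓb0 : 0 ≤ Γb)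
    (hM : ε * (1 + Real.log K + Real.log K ^ 2 / 2) = θ / p)
    (hΓε : ∀ t ∈ Icc 0 T, ∀ x, 0 < cylRadius x → cylRadius x ≤ r₀ → |swirl (v t) x| ≤ ε)
    (hΓb : ∀ t ∈ Icc 0 T, ∀ x, |swirl (v t) x| ≤ Γb) :
    ∀ t ∈ Icc 0 T,
      Wei2016.F ((ε * K) ^ (8 / 3 : ℝ)) (r₀ ^ 4)⁻¹
          ((∫ x, radVelQuot (curl (v 0)) x ^ 2) + p ^ 2 / 2 * ∫ x, angVortQuot (v 0) x ^ 2) -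
        Wei2016.hardyConst * ((4 : ℝ) ^ (2 / 3 : ℝ) *
          (192 + 8 * ‖(curlCLM : (EuclideanSpace ℝ (Fin 3) →L[ℝ] EuclideanSpace ℝ (Fin 3)) →L[ℝ]
            EuclideanSpace ℝ (Fin 3))‖ ^ 2) ^ (1 / 3 : ℝ) * ((radialConst₂ ^ 2)⁻¹) ^ (2 / 3 : ℝ) +
          (192 + 8 * ‖(curlCLM : (EuclideanSpace ℝ (Fin 3) →L[ℝ] EuclideanSpace ℝ (Fin 3)) →L[ℝ]
            EuclideanSpace ℝ (Fin 3))‖ ^ 2)) *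
        (θ + p * Γb + Γb ^ 2 / p ^ 2) * VectorCalculus.kineticEnergy u₀ ≤
      Wei2016.F ((ε * K) ^ (8 / 3 : ℝ)) (r₀ ^ 4)⁻¹
        ((∫ x, radVelQuot (curl (v t)) x ^ 2) + p ^ 2 / 2 * ∫ x, angVortQuot (v t) x ^ 2) := by
  -- opaque constants
  obtain ⟨Cg, hCg⟩ : ∃ Cg : ℝ, Cg = Wei2016.hardyConst * ((4 : ℝ) ^ (2 / 3 : ℝ) *
          (192 + 8 * ‖(curlCLM : (EuclideanSpace ℝ (Fin 3) →L[ℝ] EuclideanSpace ℝ (Fin 3)) →L[ℝ]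
            EuclideanSpace ℝ (Fin 3))‖ ^ 2) ^ (1 / 3 : ℝ) * ((radialConst₂ ^ 2)⁻¹) ^ (2 / 3 : ℝ) +
          (192 + 8 * ‖(curlCLM : (EuclideanSpace ℝ (Fin 3) →L[ℝ] EuclideanSpace ℝ (Fin 3)) →L[ℝ]
            EuclideanSpace ℝ (Fin 3))‖ ^ 2)) := ⟨_, rfl⟩
  set M₂ : ℝ := θ + p * Γb + Γb ^ 2 / p ^ 2 with hM₂
  set κ : ℝ := (ε * K) ^ (8 / 3 : ℝ) with hκ
  set ρ : ℝ := (r₀ ^ 4)⁻¹ with hρ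
  rw [← hCg]
  -- the energy `A`, its density, the enstrophy
  set A : ℝ → ℝ := fun t => (∫ x, radVelQuot (curl (v t)) x ^ 2) + p ^ 2 / 2 * ∫ x, angVortQuot (v t) x ^ 2
    with hA
  set φ : ℝ → ℝ := fun t => (∫ x, 2 * radVelQuot (curl (v t)) x *
      radVelQuot (curl (timeDerivWithin (Icc 0 T) v t)) x) +
    p ^ 2 / 2 * ∫ x, 2 * angVortQuot (v t) x * angVortQuot (timeDerivWithin (Icc 0 T) v t) x with hφ
  set eF : ℝ → ℝ := fun t => ∫ x, frobeniusNormSq (fderiv ℝ (v t) x) with heF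
  set g : ℝ → ℝ := fun t => Cg * M₂ * eF t with hg
  change ∀ t ∈ Icc 0 T, Wei2016.F κ ρ (A 0) - Cg * M₂ * VectorCalculus.kineticEnergy u₀ ≤ Wei2016.F κ ρ (A t)
  -- basic facts
  have hU : UniqueDiffOn ℝ (Icc 0 T) := uniqueDiffOn_Icc hT
  have hcl : Icc 0 T ⊆ closure (interior (Icc 0 T)) := Icc_subset_closure_interior_Icc' hT
  have hsm : IsSmoothSpaceTimeOn (Icc 0 T) v := h.classical.smooth_velocity
  have hvs : ∀ s ∈ Icc 0 T, ContDiff ℝ ∞ (v s) := fun s hs => h.classical.contDiff_velocity hs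
  have hκ0 : 0 < κ := Real.rpow_pos_of_pos (mul_pos hε (by linarith)) _
  have hρ0 : 0 < ρ := inv_pos.2 (pow_pos hr₀ 4)
  have hCg0 : 0 ≤ Cg := by
    rw [hCg]
    have h0 : 0 ≤ ‖(curlCLM : (EuclideanSpace ℝ (Fin 3) →L[ℝ] EuclideanSpace ℝ (Fin 3)) →L[ℝ]
        EuclideanSpace ℝ (Fin 3))‖ :=
      norm_nonneg (curlCLM : (EuclideanSpace ℝ (Fin 3) →L[ℝ] EuclideanSpace ℝ (Fin 3)) →L[ℝ]
        EuclideanSpace ℝ (Fin 3))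
    exact mul_nonneg Wei2016.hardyConst_nonneg (by positivity)
  have hM₂0 : 0 ≤ M₂ := by rw [hM₂]; positivity
  -- continuity of `A`, integrability of `φ`, the balance
  obtain ⟨hAc, hφi, hbal⟩ := h.energyA_balance hT hax (p ^ 2 / 2)
  -- continuity of the enstrophy
  obtain ⟨C₁, hC₁⟩ := h.sobolev 1
  obtain ⟨C₂, hC₂⟩ := h.sobolev_dt 1
  obtain ⟨-, heFc, -⟩ := hsm.enstrophy_balance hT hC₁ hC₂
  have hgc : ContinuousOn g (Icc 0 T) := continuousOn_const.mul heFc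
  have heF0 : ∀ t, 0 ≤ eF t := fun t => integral_nonneg fun x => frobeniusNormSq_nonneg _
  have hg0 : ∀ t ∈ Icc 0 T, 0 ≤ g t := fun t _ => mul_nonneg (mul_nonneg hCg0 hM₂0) (heF0 t)
  have hA0 : ∀ t ∈ Icc 0 T, 0 ≤ A t := fun t _ =>
    add_nonneg (integral_nonneg fun x => sq_nonneg _)
      (mul_nonneg (by positivity) (integral_nonneg fun x => sq_nonneg _))
  -- uniform pointwise bounds of `v`, `Dv`
  obtain ⟨B, -, hB⟩ := h.exists_bound_velocity
  obtain ⟨B', -, hB'⟩ := h.sobolev.exists_forall_norm_iteratedFDeriv_le hvs 1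
  have hDb : ∀ t ∈ Icc 0 T, ∀ x, ‖fderiv ℝ (v t) x‖ ≤ B' := fun t ht x => by
    rw [← norm_iteratedFDeriv_one (𝕜 := ℝ) (f := v t)]; exact hB' t ht x
  have hH : ∀ t ∈ Icc 0 T, ∀ n : ℕ, ∫⁻ x, ‖iteratedFDeriv ℝ n (v t) x‖ₑ ^ 2 < ⊤ := fun t ht n => by
    obtain ⟨C, hC⟩ := h.sobolev n
    exact (hC t ht).trans_lt ENNReal.coe_lt_top
  ----------------------------------------------------------------
  -- the pointwise-in-time inequality `φ(τ) ≤ g(τ) max{A(τ)^{4/3}/κ, ρ}`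
  ----------------------------------------------------------------
  have hpt : ∀ τ ∈ Icc 0 T, φ τ ≤ g τ * max (A τ ^ (4 / 3 : ℝ) / κ) ρ := by
    intro τ hτ
    have hsl := Wei2016.slice_ode_bound h.classical hU hcl hax hτ (hH τ hτ) (hB τ hτ) (hDb τ hτ) hε hε1 hp
      hp3 hθ0 hK hr₀ hΓb0 hM (hΓε τ hτ) (hΓb τ hτ)
    -- names for the pieces at time `τ`
    obtain ⟨IJ, hIJ⟩ : ∃ IJ : ℝ, IJ = ∫ x, radVelQuot (curl (v τ)) x *
        radVelQuot (curl (timeDerivWithin (Icc 0 T) v τ)) x := ⟨_, rfl⟩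
    obtain ⟨IΩ, hIΩ⟩ : ∃ IΩ : ℝ, IΩ = ∫ x, angVortQuot (v τ) x * angVortQuot (timeDerivWithin (Icc 0 T) v τ) x :=
      ⟨_, rfl⟩
    obtain ⟨DJ, hDJ⟩ : ∃ DJ : ℝ, DJ = ∫ x, (fderiv ℝ (radVelQuot (curl (v τ))) x (EuclideanSpace.single 0 1) ^ 2 +
        fderiv ℝ (radVelQuot (curl (v τ))) x (EuclideanSpace.single 1 1) ^ 2 +
        fderiv ℝ (radVelQuot (curl (v τ))) x (EuclideanSpace.single 2 1) ^ 2) := ⟨_, rfl⟩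
    obtain ⟨DΩ, hDΩ⟩ : ∃ DΩ : ℝ, DΩ = ∫ x, (fderiv ℝ (angVortQuot (v τ)) x (EuclideanSpace.single 0 1) ^ 2 +
        fderiv ℝ (angVortQuot (v τ)) x (EuclideanSpace.single 1 1) ^ 2 +
        fderiv ℝ (angVortQuot (v τ)) x (EuclideanSpace.single 2 1) ^ 2) := ⟨_, rfl⟩
    obtain ⟨eo, heo⟩ : ∃ eo : ℝ, eo = ∫ x, ‖fderiv ℝ (v τ) x‖ ^ 2 := ⟨_, rfl⟩
    rw [← hIJ, ← hIΩ, ← hDJ, ← hDΩ, ← heo, ← hCg] at hsl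
    have hslA : 2 * (IJ + p ^ 2 / 2 * IΩ) + (1 - θ) * (DJ + p ^ 2 * DΩ) ≤
        Cg * M₂ * eo * max (A τ ^ (4 / 3 : ℝ) / κ) ρ := hsl
    -- `φ τ = 2 (IJ + p²/2 IΩ)`
    have hφτ : φ τ = 2 * (IJ + p ^ 2 / 2 * IΩ) := by
      have e1 : (∫ x, 2 * radVelQuot (curl (v τ)) x * radVelQuot (curl (timeDerivWithin (Icc 0 T) v τ)) x) =
          2 * IJ := by
        rw [hIJ, ← MeasureTheory.integral_const_mul]
        exact integral_congr_ae (Eventually.of_forall fun x => by ring)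
      have e2 : (∫ x, 2 * angVortQuot (v τ) x * angVortQuot (timeDerivWithin (Icc 0 T) v τ) x) = 2 * IΩ := by
        rw [hIΩ, ← MeasureTheory.integral_const_mul]
        exact integral_congr_ae (Eventually.of_forall fun x => by ring)
      show (∫ x, 2 * radVelQuot (curl (v τ)) x * radVelQuot (curl (timeDerivWithin (Icc 0 T) v τ)) x) +
        p ^ 2 / 2 * ∫ x, 2 * angVortQuot (v τ) x * angVortQuot (timeDerivWithin (Icc 0 T) v τ) x =
        2 * (IJ + p ^ 2 / 2 * IΩ)
      rw [e1, e2]; ring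
    -- the dissipation is nonnegative
    have hDJ0 : 0 ≤ DJ := by rw [hDJ]; exact integral_nonneg fun x => by positivity
    have hDΩ0 : 0 ≤ DΩ := by rw [hDΩ]; exact integral_nonneg fun x => by positivity
    have hdiss : 0 ≤ (1 - θ) * (DJ + p ^ 2 * DΩ) := mul_nonneg (by linarith) (by positivity)
    -- `∫ ‖Dv‖² ≤ ∫ |Dv|²_F`
    have h1τ : ContDiff ℝ 1 (v τ) := (hvs τ hτ).of_le (by norm_cast)
    have hfroi : Integrable (fun x => frobeniusNormSq (fderiv ℝ (v τ) x)) volume := by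
      have hc : Continuous fun x => frobeniusNormSq (fderiv ℝ (v τ) x) :=
        continuous_frobeniusNormSq_fderiv h1τ one_ne_zero
      refine ⟨hc.aestronglyMeasurable, ?_⟩
      rw [HasFiniteIntegral]
      calc ∫⁻ x, ‖frobeniusNormSq (fderiv ℝ (v τ) x)‖ₑ
          = ∫⁻ x, ENNReal.ofReal (frobeniusNormSq (fderiv ℝ (v τ) x)) :=
            lintegral_congr fun x => by rw [Real.enorm_eq_ofReal (frobeniusNormSq_nonneg _)]
        _ ≤ ∫⁻ x, 3 * ‖iteratedFDeriv ℝ 1 (v τ) x‖ₑ ^ 2 := lintegral_mono fun x => by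
            rw [← ofReal_norm, norm_iteratedFDeriv_one, ofReal_norm]
            exact ofReal_frobeniusNormSq_le_three_mul_enorm_sq _
        _ = 3 * ∫⁻ x, ‖iteratedFDeriv ℝ 1 (v τ) x‖ₑ ^ 2 := lintegral_const_mul' _ _ (by simp)
        _ < ⊤ := ENNReal.mul_lt_top (by simp) ((hC₁ τ hτ).trans_lt ENNReal.coe_lt_top)
    have heo_le : eo ≤ eF τ := by
      rw [heo]
      refine integral_mono_of_nonneg (Eventually.of_forall fun x => sq_nonneg _) hfroi
        (Eventually.of_forall fun x => sq_opNorm_le_frobeniusNormSq _)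
    have hmax0 : 0 ≤ max (A τ ^ (4 / 3 : ℝ) / κ) ρ := le_max_of_le_right hρ0.le
    calc φ τ = 2 * (IJ + p ^ 2 / 2 * IΩ) := hφτ
      _ ≤ Cg * M₂ * eo * max (A τ ^ (4 / 3 : ℝ) / κ) ρ := by linarith only [hslA, hdiss]
      _ ≤ Cg * M₂ * eF τ * max (A τ ^ (4 / 3 : ℝ) / κ) ρ :=
          mul_le_mul_of_nonneg_right (mul_le_mul_of_nonneg_left heo_le (mul_nonneg hCg0 hM₂0)) hmax0
      _ = g τ * max (A τ ^ (4 / 3 : ℝ) / κ) ρ := by rw [hg]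
  ----------------------------------------------------------------
  -- `A(t) − A(s) ≤ ∫ₛᵗ g max{…}`
  ----------------------------------------------------------------
  have hA43 : ContinuousOn (fun τ => A τ ^ (4 / 3 : ℝ)) (Icc 0 T) :=
    hAc.rpow_const fun τ _ => Or.inr (by norm_num)
  have hψc : ContinuousOn (fun τ => g τ * max (A τ ^ (4 / 3 : ℝ) / κ) ρ) (Icc 0 T) :=
    hgc.mul (continuous_max.comp_continuousOn ((hA43.div_const κ).prodMk continuousOn_const))
  have hineq : ∀ s t, 0 ≤ s → s ≤ t → t ≤ T →
      A t - A s ≤ ∫ τ in s..t, g τ * max (A τ ^ (4 / 3 : ℝ) / κ) ρ := by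
    intro s t hs hst htT
    rw [show A t - A s = ∫ τ in s..t, φ τ from hbal s t hs hst htT]
    have hφI : IntervalIntegrable φ volume s t := by
      rw [intervalIntegrable_iff_integrableOn_Ioo_of_le hst]
      exact hφi.mono_set (Ioo_subset_Ioo hs htT)
    have hψI : IntervalIntegrable (fun τ => g τ * max (A τ ^ (4 / 3 : ℝ) / κ) ρ) volume s t :=
      (hψc.mono (Icc_subset_Icc hs htT)).intervalIntegrable_of_Icc hst
    exact intervalIntegral.integral_mono_on hst hφI hψI fun τ hτ => hpt τ ⟨hs.trans hτ.1, hτ.2.trans htT⟩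
  ----------------------------------------------------------------
  -- `∫₀ᵗ g ≤ Cg M₂ E(u₀)`
  ----------------------------------------------------------------
  have hGb : ∀ t ∈ Icc 0 T, ∫ s in (0 : ℝ)..t, g s ≤ Cg * M₂ * VectorCalculus.kineticEnergy u₀ := by
    intro t ht
    have h1 := h.intervalIntegral_enstrophy_le hT ht
    rw [show (fun s => g s) = fun s => Cg * M₂ * eF s from rfl, intervalIntegral.integral_const_mul]
    exact mul_le_mul_of_nonneg_left h1 (mul_nonneg hCg0 hM₂0)
  exact Wei2016.F_sub_le_F_of_integral_le hκ0 hρ0 hT hAc hgc hA0 hg0 hineq hGb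

end Apriori

end Literature.Analysis.FluidPDE

end
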